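import Summits.MatrixMultiplication.MatrixMultiplication.Theorems.ObstructionDescentUniversalOccurrenceTwoRectangleHookTypes
import Summits.MatrixMultiplication.MatrixMultiplication.Theorems.ObstructionDescentUniversalOccurrenceTwoRectangleFourTwo
import Summits.MatrixMultiplication.MatrixMultiplication.Theorems.ObstructionDescentUniversalOccurrenceTwoRectangleFourTwoTwo
import Summits.MatrixMultiplication.MatrixMultiplication.Theorems.ObstructionDescentUniversalOccurrenceTwoRectangleTwoRowsFour

set_option linter.dupNamespace false
set_option autoImplicit false

/-!
# Universal occurrence — two rectangles: every type with `ν₂ ≤ 4`, `ν₃ ≤ 2` (decomp-mm · lens 3 · gen 43, summary K26/K27)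

Route `route-MatrixMultiplication-ObstructionDescent` (sub-problem `MatrixMultiplication`, `ω(ℂ) = 2`); SUPPORT for the crux
`NoOccurrenceObstruction` (`P_O`, item `stmt-MatrixMultiplication-29040`) through the universal-occurrence programme (NODE-g29…g43
of the decomp-mm cell, lens 3).  Nothing here proves `ω = 2` or closes an item; no `def`, no `sorry`, standard axioms.

**Claim** (`occurs_unitTensor_twoRectangle_smallTypes`).  Let `ν ⊢ 2N` have sorted parts `a :: rest` with
`rest ∈ {[], [2], [2,2], [2,2,2], [4], [4,2], [4,2,2]}` — equivalently: `ν` is even with at most four rows, `ν₂ ≤ 4` and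
`ν₃ ≤ 2` (the first part `a = 2N - Σ rest` and the floor `N ≥ #rows`, resp. `N ≥ 5, 6` for `[4,2]`, `[4,2,2]`, are forced by
`Σ ν = 2N` and monotonicity).  Then the isotypic component of type `((2^N),(2^N),ν)` of `Sym^{2N}(ℂ^m ⊗ ℂ^m ⊗ ℂ^m)` does not vanish on
the orbit closure of the unit tensor `⟨m⟩`, for EVERY `m ≥ N` — i.e. none of these types is an occurrence obstruction against any
tensor of border rank `≥ N` (where the two-rectangular types of degree `2N` first appear).  This packages the seven uniform-in-`N`
families certified in Lean by the K23 floor law with explicit designs: the doubled hooks `(2N-2j,2^j)`, `j ≤ 3`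
(`occurs_unitTensor_twoRectangle_doubleHook`), `(2N-4,4)` (`…_twoRowsFour`), `(2N-6,4,2)` (`…_fourTwo`), `(2N-8,4,2,2)`
(`…_fourTwoTwo`).

[cite: BurgisserIkenmeyer2011, §3.4 (Prop. 3.4), Thm. 4.4] [cite: BurgisserIkenmeyer2017, §5, Thm. 5.9 (proof of (2)), eq. (3.4)]
[cite: Landsberg2017, §9.1.1]
-/

noncomputable section

open scoped BigOperators

namespace Summit.MatrixMultiplication.MatrixMultiplication.Theorems.ObstructionCalculus

open Literature.Computability.AlgebraicComplexity
open Literature.NumberTheory.DiophantineGeometry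

/-- **Every type `((2^N),(2^N),ν)` with `ν₂ ≤ 4`, `ν₃ ≤ 2` occurs for `⟨m⟩`, all `m ≥ N`.** [cite: BurgisserIkenmeyer2011, Thm. 4.4]
[cite: BurgisserIkenmeyer2017, Thm. 5.9 (proof of (2))] -/
theorem occurs_unitTensor_twoRectangle_smallTypes {N m : ℕ} (hNm : N ≤ m)
    {lam : Fin 3 → Nat.Partition (N * 2)} (h0 : lam 0 = Nat.Partition.rectangle N 2)
    (h1 : lam 1 = Nat.Partition.rectangle N 2) {a : ℕ} {rest : List ℕ}
    (hrest : rest ∈ [[], [2], [2, 2], [2, 2, 2], [4], [4, 2], [4, 2, 2]])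
    (h2 : (lam 2).sortedParts = a :: rest) :
    isotypicSum₁ (lam 0) (isotypicSum₂ (lam 1) (isotypicSum₃ (lam 2)
      (kroneckerPow (unitTensor ℂ m) (N * 2)))) ≠ 0 := by
  have hsum : a + rest.sum = N * 2 := by
    have h := (lam 2).sum_sortedParts
    rwa [h2, List.sum_cons] at h
  have hsort : ∀ b ∈ rest, b ≤ a := by
    have h := List.sortedGE_iff_pairwise.mp (lam 2).sortedGE_sortedParts
    rw [h2, List.pairwise_cons] at h
    exact h.1
  have hapos : 0 < a := (lam 2).pos_of_mem_sortedParts (by rw [h2]; exact List.mem_cons_self)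
  simp only [List.mem_cons, List.not_mem_nil, or_false] at hrest
  rcases hrest with rfl | rfl | rfl | rfl | rfl | rfl | rfl
  · -- `ν = (2N)`
    simp only [List.sum_nil] at hsum
    obtain rfl : a = 2 * N - 2 * 0 := by omega
    exact occurs_unitTensor_twoRectangle_doubleHook (j := 0) (by norm_num) (by omega) hNm h0 h1 (by rw [h2]; rfl)
  · -- `ν = (2N-2, 2)`
    simp only [List.sum_cons, List.sum_nil] at hsum
    obtain rfl : a = 2 * N - 2 * 1 := by omega
    exact occurs_unitTensor_twoRectangle_doubleHook (j := 1) (by norm_num) (by omega) hNm h0 h1 (by rw [h2]; rfl)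
  · -- `ν = (2N-4, 2, 2)`
    simp only [List.sum_cons, List.sum_nil] at hsum
    obtain rfl : a = 2 * N - 2 * 2 := by omega
    exact occurs_unitTensor_twoRectangle_doubleHook (j := 2) (by norm_num) (by omega) hNm h0 h1 (by rw [h2]; rfl)
  · -- `ν = (2N-6, 2, 2, 2)`
    simp only [List.sum_cons, List.sum_nil] at hsum
    obtain rfl : a = 2 * N - 2 * 3 := by omega
    exact occurs_unitTensor_twoRectangle_doubleHook (j := 3) (by norm_num) (by omega) hNm h0 h1 (by rw [h2]; rfl)
  · -- `ν = (2N-4, 4)`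
    simp only [List.sum_cons, List.sum_nil] at hsum
    have h4 := hsort 4 (by simp)
    obtain rfl : a = 2 * N - 4 := by omega
    exact occurs_unitTensor_twoRectangle_twoRowsFour (by omega) hNm h0 h1 h2
  · -- `ν = (2N-6, 4, 2)`
    simp only [List.sum_cons, List.sum_nil] at hsum
    have h4 := hsort 4 (by simp)
    obtain rfl : a = 2 * N - 6 := by omega
    exact occurs_unitTensor_twoRectangle_fourTwo (by omega) hNm h0 h1 h2
  · -- `ν = (2N-8, 4, 2, 2)`
    simp only [List.sum_cons, List.sum_nil] at hsum
    have h4 := hsort 4 (by simp)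
    obtain rfl : a = 2 * N - 8 := by omega
    exact occurs_unitTensor_twoRectangle_fourTwoTwo (by omega) hNm h0 h1 h2

end Summit.MatrixMultiplication.MatrixMultiplication.Theorems.ObstructionCalculus
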